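import Literature.Analysis.FluidPDE.NSBoundedHigherRegularityQuantProofs
import Literature.Analysis.FluidPDE.SuitableWeak
import HarnessLib

/-!
# Route `AxisTwistDoor`, crux `AveragedConeLiouville` (stmt-NavierStokesRegularity-26889) — INPUT N3 (`ShellFact` by the
# compactness–contradiction route), piece S2: POINTWISE VELOCITY AND GRADIENT BOUNDS FROM ESSENTIAL BOUNDEDNESS

N3 cut of record (pub/ns-inputs STATUS 2026-08-28T12:41:44Z, texts OK 12:52:02Z; `kits/N3-skeleton.lean` 815f0a7c119d2985,
`Sig.gradBound`; plan g6's remark r2).  For `R > 0`, `M`, `P` there is `B = B(R,M,P)`: a suitable weak solution `(v,π)` (`ν = 1`,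
`f = 0`) on `Q(z,R)` with `v` CONTINUOUS on `Q(z,R)`, `|v| ≤ M` a.e. there and `∫∫_{Q(z,R)} |π|^{3/2} ≤ P` satisfies
`‖v(t,x)‖ ≤ B`, `‖fderiv ℝ (v t) x‖ ≤ B` at EVERY point of `Q(z,R/2)`.  BY NAME from Seregin–Šverák's bounded-solution regularity
with norms (`NSBoundedHigherRegularityBounds_holds`, orders `n = 0, 1`, radius `R/2`): its smooth representative `V` is jointly
continuous on `Q(z,3R/4)` (the joint Hölder clause at order `0`), so the continuous `v` EQUALS `V` there
(`Measure.eqOn_open_of_ae_eq`), whence `‖v‖ = ‖D⁰V‖ ≤ K 0 (R/2)` and, slice by slice on the open ball, `fderiv (v t) = fderiv (V t)`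
(`Filter.EventuallyEq.fderiv_eq`) with `‖fderiv (V t) x‖ = ‖D¹V‖ ≤ K 1 (R/2)`.

* **`gradBound`** — the piece (`Sig.gradBound` verbatim).

No NS statement is proved; N3 is an INPUT toward `ShellFact`; item 26889 and the summit stay OPEN.
`--supports stmt-NavierStokesRegularity-26889 --as helper`. [cite: SereginSverak2009, §2 p. 8]
-/

noncomputable section

-- the summit and its single sub-problem share the name (CONVENTIONS §1)
set_option linter.dupNamespace false

open MeasureTheory Set Function Metric Filter Topology
open scoped NNReal ENNReal

namespace Summit.NavierStokesRegularity.NavierStokesRegularity.Theorems.AveragedConeLiouville.Shell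

open Literature.Analysis Literature.Analysis.FluidPDE

/-- **S2 `stub_gradBound` of the N3 skeleton (`Sig.gradBound` verbatim).** Pointwise bounds on `v` and `fderiv (v t)` on
`Q(z,R/2)` for a continuous, essentially bounded suitable weak solution with `L^{3/2}` pressure on `Q(z,R)`, with a constant
depending on `(R, M, P)` only. [cite: SereginSverak2009, §2 p. 8] -/
theorem gradBound :
    ∀ (R M : ℝ) (P : ℝ≥0), 0 < R → ∃ B : ℝ, 0 ≤ B ∧
      ∀ (v : ℝ → EuclideanSpace ℝ (Fin 3) → EuclideanSpace ℝ (Fin 3)) (π : ℝ → EuclideanSpace ℝ (Fin 3) → ℝ)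
        (z : ℝ × EuclideanSpace ℝ (Fin 3)),
        IsSuitableWeakSolutionOn (parabolicCylinderOpens R z) 1 0 v π →
        ContinuousOn (uncurry v) (parabolicCylinder R z) →
        (∀ᵐ w ∂(volume.restrict (parabolicCylinder R z)), ‖v w.1 w.2‖ ≤ M) →
        ∫⁻ w in parabolicCylinder R z, ‖π w.1 w.2‖ₑ ^ (3 / 2 : ℝ) ≤ (P : ℝ≥0∞) →
        ∀ w ∈ parabolicCylinder (R / 2) z, ‖v w.1 w.2‖ ≤ B ∧ ‖fderiv ℝ (v w.1) w.2‖ ≤ B := by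
  intro R M P hR
  obtain ⟨K, C, α, hα, hmain⟩ := NSBoundedHigherRegularityBounds_holds R M P
  refine ⟨max (K 0 (R / 2) : ℝ) (K 1 (R / 2)), le_max_of_le_left (K 0 (R / 2)).coe_nonneg, ?_⟩
  intro v π z hsw hcont hM hP w hw
  obtain ⟨V, hae, -, hreg⟩ := hmain v π z hsw.distributional hM hP
  have hr2 : R / 2 ∈ Ioo 0 R := ⟨by positivity, by linarith⟩
  have hr3 : 3 * R / 4 ∈ Ioo 0 R := ⟨by positivity, by linarith⟩
  obtain ⟨-, hK0⟩ := hreg 0 (R / 2) hr2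
  obtain ⟨-, hK1⟩ := hreg 1 (R / 2) hr2
  obtain ⟨hHol, -⟩ := hreg 0 (3 * R / 4) hr3
  -- nested cylinders
  have hmono : ∀ {r r' : ℝ}, 0 ≤ r → r ≤ r' → parabolicCylinder r z ⊆ parabolicCylinder r' z := by
    intro r r' hr hrr' q hq
    refine ⟨⟨?_, hq.1.2⟩, ball_subset_ball hrr' hq.2⟩
    have h1 : r ^ 2 ≤ r' ^ 2 := by nlinarith
    linarith [hq.1.1]
  -- the representative is jointly continuous on `Q(z, 3R/4)`
  set U : Set (ℝ × EuclideanSpace ℝ (Fin 3)) := parabolicCylinder (3 * R / 4) z with hU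
  have hUo : IsOpen U := isOpen_parabolicCylinder _ _
  have hUR : U ⊆ parabolicCylinder R z := hmono (by positivity) (by linarith)
  have hVc : ContinuousOn (uncurry V) U := by
    have h1 : ContinuousOn (fun w : ℝ × EuclideanSpace ℝ (Fin 3) => iteratedFDeriv ℝ 0 (V w.1) w.2) U :=
      hHol.continuousOn (hα 0 _ hr3)
    have h2 : ContinuousOn (fun w : ℝ × EuclideanSpace ℝ (Fin 3) =>
        iteratedFDeriv ℝ 0 (V w.1) w.2 (fun _ => (0 : EuclideanSpace ℝ (Fin 3)))) U :=
      (continuous_eval_const (fun _ : Fin 0 => (0 : EuclideanSpace ℝ (Fin 3)))).comp_continuousOn h1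
    refine h2.congr fun w _ => ?_
    simp only [iteratedFDeriv_zero_apply]
    rfl
  -- the continuous `v` equals its representative on `U`
  have hEq : EqOn (uncurry v) (uncurry V) U :=
    Measure.eqOn_open_of_ae_eq (ae_restrict_of_ae_restrict_of_subset hUR hae) hUo (hcont.mono hUR) hVc
  -- the point `w = (t, x)` of `Q(z, R/2) ⊆ U`
  have hw2 : w ∈ parabolicCylinder (R / 2) z := hw
  have hwU : w ∈ U := hmono (by positivity) (by linarith) hw
  have hvw : v w.1 w.2 = V w.1 w.2 := hEq hwU
  constructor
  · rw [hvw, ← norm_iteratedFDeriv_zero (𝕜 := ℝ)]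
    exact (hK0 w hw2).trans (le_max_left _ _)
  · -- `v t = V t` near `x`, so the derivatives agree
    have hnhds : (v w.1) =ᶠ[𝓝 w.2] (V w.1) := by
      have hball : ball z.2 (3 * R / 4) ∈ 𝓝 w.2 := isOpen_ball.mem_nhds (by
        have h := hwU.2; exact h)
      filter_upwards [hball] with y hy
      exact hEq (show (w.1, y) ∈ U from ⟨hwU.1, hy⟩)
    rw [hnhds.fderiv_eq, ← norm_iteratedFDeriv_zero (𝕜 := ℝ) (f := fderiv ℝ (V w.1)), norm_iteratedFDeriv_fderiv]
    exact (hK1 w hw2).trans (le_max_right _ _)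

end Summit.NavierStokesRegularity.NavierStokesRegularity.Theorems.AveragedConeLiouville.Shell

end
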